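import Summits.AnomalousDissipation.AnomalousDissipation.Theorems.QuarticGate.Negative.Laminar
import Summits.AnomalousDissipation.AnomalousDissipation.Theorems.CubicParityLoud.Negative.EnergyRow

/-!
# Disproof of `ResolvedDissipation` — work file of the standing disprover (crux stmt-AnomalousDissipation-14284)

cdisprove seat `refuter-cdisprove-stmt-AnomalousDissipation-14284-0`, route `MomentParity` (rank-5 crux).
Everything below is `lean check`ed (rc 0, no `sorry`; axioms ⊆ {propext, Classical.choice, Quot.sound}) and
LANDED verbatim under `Theorems/ResolvedDissipation/Negative/`: `ShearMode.lean` (§0–§1; p83281) · `LoadBearing.lean`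
(§2, §4; p85799) · `KillShape.lean` (§3, §5–§7; p85462) — import
`Summits.AnomalousDissipation.AnomalousDissipation.Theorems.ResolvedDissipation.Negative.{LoadBearing,KillShape}` for all of it.
The prose reduction (why it resists) is `Cruxes/ResolvedDissipation/WhyItResists.md`.

## Findings (cycle 1)

* **NO KILL, and none is cheap.** The crux as typed is faithful (junk audit clean: `eGradNormSq`,
  `fourierTruncate`, `IsLevel` are spectral hence representative-independent; all lintegrals are finite on
  level-`N` laws with bounded support; `R < 0` only makes the hypotheses unsatisfiable; `N = 0` forces
  `μ = δ₀`). `¬ResolvedDissipation` ⟺ for one `(f, ν > 0, R)` there is `δ > 0` such that for EVERY cutoff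
  `K` some Galerkin-invariant law at some level `N > K`, supported in `B_R`, holds mean enstrophy `≥ δ`
  above `K`. Passing to a weak-* limit point `μ_∞` on `(B_R, weak)` (`e_K(u) = ‖∇P_K u‖²` and `(f,·)` are
  weakly continuous and bounded there, `e = sup_K e_K` is weakly lsc, and the energy row
  `ν e(μ_N) = ∫(f,u)dμ_N` holds exactly at each level, §6) this is EQUIVALENT to: some weak-* limit of
  invariant level-`N` laws in `B_R` — a Galerkin-limit (Vishik–Fursikov) stationary statistical solution of
  3-D NS at `(f, ν)` — has STRICT mean energy inequality `ν⟨‖∇u‖²⟩ ≤ ⟨(f,u)⟩ − νδ` (the rows of `μ_∞` are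
  NOT obtained by weak continuity — `u ↦ b(u,u,g)` is not weakly continuous — but from the VF lift below;
  they are not used). Through the Vishik–Fursikov lift of the same stationary Galerkin laws (tight on
  `C([0,T];H_w) ∩ L²(0,T;H)`, limit carried by Leray–Hopf paths, time-0 marginal = that limit law,
  `E‖∇u(t)‖² = e(μ)` for a.e. `t` by shift-invariance) a kill therefore PRODUCES Leray–Hopf solutions of
  3-D NS with smooth steady force and STRICT energy inequality on a set of positive measure of initial data
  — anomalous dissipation at FIXED `ν > 0` in the Leray–Hopf class, which is open: energy equality for
  Leray–Hopf solutions is known only under extra integrability (Lions/Shinbrot `L⁴L⁴`; `L³B^{1/3}_{3,c₀}`,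
  arXiv:0704.0759; doi:10.1016/j.na.2019.111704; weak-in-time Onsager classes doi:10.1088/1361-6544/ab60d3),
  the 3-D theory DEFINES stationary statistical solutions with the mean energy INEQUALITY
  (FMRT IV (1.31); doi:10.1007/s10884-018-9719-2 = arXiv:1606.02174, §4 Def. 4.1 and Rem. 4.1, "not known
  to generate a well-defined semigroup"), and no construction reaches the Leray–Hopf class with an energy
  defect (convex-integration solutions are not Leray–Hopf; Leray–Hopf NON-UNIQUENESS is known only along the
  Jia–Šverák programme, with no dissipation anomaly: barrier
  `Literature.Barriers.AnomalousDissipation.BuckmasterVicol2019_thm13`, scope_caveats (a)). Precisely: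
  [every Leray–Hopf solution of NS at `(f, ν)` with data in `B_R` satisfies the energy equality] ⟹ RD at
  `(f, ν, R)` (average the pathwise equality under the Vishik–Fursikov limit), and ¬RD ⟹ a positive-measure
  set of Leray–Hopf paths with STRICT energy inequality. MORE: the limit law `μ_∞` has finite mean enstrophy
  (`e(μ_∞) ≤ liminf e(μ_N) ≤ ‖f‖R/ν`), so it is carried by `V`; the VF paths start (at a.e. time, by
  shift-invariance) from `V`-valued data where the energy inequality holds, and by weak–strong uniqueness
  (the strong solution from `V`-data lies in `L^∞_t L⁶_x`, a Serrin class) each such path IS the strong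
  solution up to its maximal time `T*` and satisfies the energy EQUALITY on `[0, T]` whenever `T* > T`.
  Hence `E_P[energy defect on [0,T]] = T(⟨(f,u)⟩ − ν e(μ_∞)) ≥ Tνδ > 0` forces `P(T* ≤ T) > 0`:
  **¬ResolvedDissipation ⟹ finite-time blow-up of 3-D NS on `T³` with a smooth time-independent force from
  a `μ_∞`-positive set of `V`-valued (hence, an instant later, smooth) data** — a disproof of the crux is a
  negative solution of the forced periodic regularity problem, with the singularities statistically
  persistent (positive mean Duchon–Robert defect at fixed `ν` under an invariant Galerkin-limit ensemble).
  Contrapositively, global regularity at `(f, ν)` ⟹ Leray–Hopf energy equality ⟹ RD at `(f, ν, R)` for all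
  `R`. So the crux is GENUINELY OPEN, pinned between NS regularity (implies it) and statistically visible
  blow-up (its negation); nothing short of that refutes it. No small model can bite: every explicitly constructible
  invariant law of a Galerkin truncation (Diracs at steady states, laminar families) is `N`-uniformly `H²`
  by the elliptic bootstrap `ν|Au| ≲ ‖f‖ + ‖∇u‖^{3/2}|Au|^{1/2}`; periodic / chaotic invariant sets of
  truncated NS are not constructible here, and numerically the standard resolved-DNS picture holds (next item).
* **NUMERICS (kit jobs j014257 `ν = 0.03`, j014256 `ν = 0.04`; 2π-box units, Galerkin NS with spherical
  truncation `|k| ≤ N` evaluated alias-free on a `(3N+2)³` grid, IFRK4, Kolmogorov force `sin(2y)e_x` — with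
  `k_f = 1` the laminar state is stable in the cube and the first run j012278 relaminarised — time averages over
  140 time units after 40 of spin-up, from the perturbed laminar state).** Energy row `ν⟨Z⟩ = ⟨(f,u)⟩` holds to
  0.5% at every level. Mean energy / enstrophy are `N`-independent to ≈4%: `ν = 0.04`: `E = 1.00/1.04/1.01`,
  `Z = 8.86/9.02/8.60` at `N = 8/12/16` (`k_d ≈ 8.6`); `ν = 0.03`: `E = 1.08/1.08/1.13`, `Z = 12.9/13.1/13.1`
  (`k_d ≈ 11`). TAIL FRACTIONS `⟨Σ_{|k|>K}|k|²|û_k|²⟩/⟨Z⟩` are `N`-INDEPENDENT within sampling error: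
  `ν = 0.04`: `K = 6`: `0.0525/0.0530/0.0498`, `K = 8`: `–/0.0176/0.0163`, `K = 10`: `–/0.0051/0.0048`;
  `ν = 0.03`: `K = 6`: `0.115/0.123/0.119`, `K = 8`: `–/0.053/0.051`, `K = 10`: `–/0.019/0.020`
  (`N = 8/12/16`); and the TOP-SHELL fraction decays geometrically with the level — `1.8e-2 → 1.8e-3 → 1.8e-4`
  (`ν = 0.04`), `4.1e-2 → 7.0e-3 → 1.3e-3` (`ν = 0.03`) — an exponential dissipation-range tail, no cutoff
  pile-up. (Levels `N = 24, 32` were still running at the time of writing; full tables in the jobs' `outputs/`,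
  attached to the item automatically.) This is evidence FOR the crux at these `(f, ν)` — as every converged DNS
  is — and says nothing about rare intermittent excursions, which is where a counterexample would have to live.
* **§2 LOAD-BEARING HYPOTHESES (all three refuted when dropped, one witness):** the Dirac law at the shear
  mode `K_{M,1} = cos(2πM x₁)e₀`, `M = κ 0 + 1` (energy `1/2`, enstrophy `2π²M²`, all on the shell `M`,
  `P_{κ 0} K_M = 0`):
  `resolvedDissipation_false_without_nu_pos` (`0 ≤ ν`: at `ν = 0`, `f = 0` every shear mode is an exact
  steady state of every Galerkin–Euler truncation — no viscosity, no dissipation scale; the ensemble version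
  is equipartition of truncated Euler); `resolvedDissipation_false_without_stationarity` (drop the rows:
  nothing ties `μ` to `(ν, f)`); `resolvedDissipation_false_without_level` (drop the carrier clause on `μ`,
  keep band-limited tests: at `ν = 1`, `f = 0`, level `N = 0 < M` the DECAYING mode `δ_{K_M}` passes every
  level-`N` row — `⟨F(K_M), w⟩ = −4π²M²ν (K_M, w) = 0` for `ŵ(±Me₁) = 0` — a law above the tests is
  invisible to them; stationarity is Liouville only for laws carried by the tests' own Galerkin space).
* **§3 THE QUANTIFIER ORDER IS THE WHOLE CONTENT:** `resolvedDissipationLevelwise_holds` — with `∀ N ∃ κ`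
  the statement is trivial (`κ ≡ N`, exact: `‖∇P_N u‖² = ‖∇u‖²` on level-`N` fields,
  `eGradNormSq_fourierTruncate_of_isLevel`), using no stationarity, support or viscosity. So any proof must
  produce an `N`-UNIFORM modulus for the enstrophy tail `K ↦ sup_{N, μ} ∫‖∇Q_K u‖² dμ` of invariant laws.
* **`R` is (probably) NOT load-bearing quantitatively** (information for the prover, not a theorem here):
  compactly supported invariant laws of the dissipative Galerkin ODE live in the absorbing ball
  `‖u‖ ≤ ‖f‖₂/(4π²ν)` (`supp μ ⊆ ⋂_t S_t(B_R)`), so `κ = κ(f, ν)`; the clause `∀ᵐ ‖u‖ ≤ R` is needed only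
  qualitatively (compact support ⇒ polynomial rows = Liouville ⇒ invariance; without it moment-indeterminate
  non-invariant "row-stationary" laws exist in principle).
* **Known `N`-uniform inputs and why they do not suffice** (for ideators): the energy row
  `ν∫‖∇u‖² = ∫(f,u) ≤ ‖f‖₂R` (`CubicParityLoud/Negative/EnergyRow`); Foias–Guillopé–Temam
  `⟨|Au|^{2/3}⟩ ≤ c(f, ν, R)` (FMRT IV (3.6)) — an `H²`-moment of order `2/3 < 2` cannot control the tail
  of the quadratic quantity `‖∇Q_K u‖²` (intermittent laws: mass `p` at `|Au|² = Λ` costs `pΛ^{1/3}` but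
  leaks `pΛ/K²`... choose `p = Λ^{-1/3}`); the enstrophy row `ν⟨|Au|²⟩ = ⟨(f, Au)⟩ + ⟨b(u,u,Au)⟩` carries
  the unsigned vortex-stretching term (it vanishes in 2-D, which is exactly why the `d = 2` analogue
  `IsStationaryStatisticalSolution.energy_eq_holds` is a theorem in tree). What WOULD suffice: any
  `N`-uniform bound `∫ ‖u‖²_{H^{1+s}} dμ ≤ C` (`s > 0`) over invariant laws, or `N`-uniform integrability
  of `‖∇u‖²·1_{‖∇u‖² > Λ}` plus `H^{1+s}` control on `{‖∇u‖² ≤ Λ}` — both are conditional-regularity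
  statements for 3-D NS at fixed `ν`.

## Contents
§0 vocabulary (`IsStationary`, `IsResolved`, `resolvedDissipation_iff` by `Iff.rfl`; `IsLevel`/`IsBandTest`/
`polyGrad` from `QuarticGate/Negative/LevelCeiling`) · §1 the shear mode `K_{M,a}` at frequency `M e₁`
(steady for Galerkin NS at force `4π²νM²K_{M,a}`, for Euler at zero force, invisible below its shell;
energy `a²/2`, enstrophy `2π²M²a²`, `P_K K_M = 0` for `K < M`) · §2 `_false_without_` (ν > 0 /
stationarity / level) · §3 levelwise triviality (`∀N ∃κ`) · §4 refuted strengthening: no schedule uniform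
in the force (laminar single-mode family) · §5 kill shape (`¬RD ↔ KillShape`: ∃(f,ν,R,n) ∀K ∃ unresolved
invariant law, necessarily at level `N > K`) · §6 the `N`-uniform budget `∫⁻‖∇u‖² dμ ≤ ‖f‖₂R/ν` (energy row)
· §7 schedule calculus (resolution monotone in cutoff and tolerance: WLOG `κ` monotone) · no `-- Targets` yet (`stuck_stubs = []`, no line picked).
-/

noncomputable section

-- `Summit.<Summit>.<Problem>` is the tree's mandated summit-side namespace (CONVENTIONS §2); for this
-- single-conjunct summit the two segments coincide, so the duplicate is deliberate.
set_option linter.dupNamespace false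

namespace Summit.AnomalousDissipation.AnomalousDissipation.Cruxes.ResolvedDissipation.Disproof

open MeasureTheory Filter Topology
open scoped ENNReal InnerProductSpace RealInnerProductSpace
open Literature.Analysis.FunctionSpaces Literature.Analysis.FluidPDE
open Summit.AnomalousDissipation.AnomalousDissipation.Theses.MomentParity
open Summit.AnomalousDissipation.AnomalousDissipation.Theorems.QuarticGate.Negative

/-- The 3-torus. -/
abbrev T3 : Type := UnitAddTorus (Fin 3)
/-- Velocity values. -/
abbrev R3 : Type := EuclideanSpace ℝ (Fin 3)
/-- The energy space `H = L²_σ(T³)` of the crux. -/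
abbrev H3 : Type := ↥(Torus.energySpace (Fin 3))

/-- Local notation for the real Hilbert space `L²(T³; ℝ³)`. -/
local notation "L2T3" => Lp (EuclideanSpace ℝ (Fin 3)) 2 (volume : Measure (UnitAddTorus (Fin 3)))

/-! ## §0 Vocabulary: the clauses of the crux, named (verbatim sub-terms of `ResolvedDissipation`)

`IsLevel`, `IsBandTest`, `polyGrad` are the accepted ones of
`Theorems/QuarticGate/Negative/LevelCeiling.lean` (same sub-terms in every item of the route). -/

/-- Stationarity at EVERY order for Galerkin NS at `(ν, f)` and level `N`: all polynomial cylindrical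
observables with level-`N` band tests are drift-free (row integrable and `0`) — the crux's hypothesis
(no degree bound, unlike `IsPolyStationary ν f N d`). [folklore] -/
def IsStationary (ν : ℝ) (f : T3 → R3) (N : ℕ) (μ : Measure H3) : Prop :=
  ∀ (m : ℕ) (g : Fin m → T3 → R3) (P : MvPolynomial (Fin m) ℝ), (∀ i, IsBandTest N (g i)) →
    Integrable (fun u => Torus.nsGeneratorPairing ν f u (polyGrad g P u)) μ ∧
      ∫ u, Torus.nsGeneratorPairing ν f u (polyGrad g P u) ∂μ = 0

/-- `κ`-resolution of the mean enstrophy of `μ` at tolerance `1/(n+1)`: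
`∫ ‖∇u‖² dμ ≤ ∫ ‖∇P_{κ n} u‖² dμ + (n+1)⁻¹` — the crux's conclusion. [folklore] -/
def IsResolved (κ : ℕ → ℕ) (μ : Measure H3) (n : ℕ) : Prop :=
  ∫⁻ u : H3, Torus.eGradNormSq (u.1 : T3 → R3) ∂μ ≤
    (∫⁻ u : H3, Torus.eGradNormSq (Torus.fourierTruncate (κ n) (u.1 : T3 → R3)) ∂μ) +
      ((n : ℝ≥0∞) + 1)⁻¹

/-- `ResolvedDissipation` restated through the vocabulary (definitional unfolding, `Iff.rfl`):
`∀ f ν R, ∃ κ, ∀ N μ` — ONE schedule for all levels and all invariant laws in the ball. [folklore] -/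
theorem resolvedDissipation_iff :
    ResolvedDissipation ↔ ∀ f : T3 → R3, Torus.IsSmooth f → Torus.IsDivFree f → Torus.HasZeroMean f →
      ∀ ν : ℝ, 0 < ν → ∀ R : ℝ, ∃ κ : ℕ → ℕ, ∀ (N : ℕ) (μ : Measure H3), IsProbabilityMeasure μ →
        (∀ᵐ u ∂μ, IsLevel N u) → (∀ᵐ u ∂μ, ‖u‖ ≤ R) → IsStationary ν f N μ → ∀ n, IsResolved κ μ n :=
  Iff.rfl

/-! ## §1 The shear mode at frequency `M`: `K_{M,a}(x) = a cos(2πM x₁) e₀`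

An exact steady state of Galerkin NS at every truncation containing it (force `4π²νM² K_{M,a}`), of Euler
(`ν = 0`, any force-free truncation), with ALL its enstrophy `2π²M²a²` on the shell `|k| = M` and energy
`a²/2` independent of `M`. -/

/-- The frequency `M e₁ = (0, M, 0)`. [folklore] -/
def shearFreq (M : ℕ) : Fin 3 → ℤ := Pi.single 1 (M : ℤ)

/-- The symmetric pair `{M e₁, −M e₁}`. [folklore] -/
def shearSet (M : ℕ) : Finset (Fin 3 → ℤ) := {shearFreq M, -shearFreq M}

/-- The shear mode `K_{M,a}(x) = a cos(2πM x₁) e₀` (coefficients `(a/2) e₀` = `kolCoeff a` on `{±M e₁}`). [folklore] -/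
def shearField (M : ℕ) (a : ℝ) : T3 → R3 := Torus.realTrigPoly (shearSet M) (kolCoeff a)

/-- `shearFreq_apply_zero` (bookkeeping for the shear-mode family). [folklore] -/
theorem shearFreq_apply_zero (M : ℕ) : shearFreq M 0 = 0 := by simp [shearFreq]

/-- `shearFreq_apply_one` (bookkeeping for the shear-mode family). [folklore] -/
theorem shearFreq_apply_one (M : ℕ) : shearFreq M 1 = M := by simp [shearFreq]

/-- `shearFreq_ne_zero` (bookkeeping for the shear-mode family). [folklore] -/
theorem shearFreq_ne_zero {M : ℕ} (hM : M ≠ 0) : shearFreq M ≠ 0 := fun h => by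
  have := congrFun h 1
  simp [shearFreq] at this
  exact hM this

/-- `freqNormSq_shearFreq` (bookkeeping for the shear-mode family). [folklore] -/
theorem freqNormSq_shearFreq (M : ℕ) : Torus.freqNormSq (shearFreq M) = (M : ℝ) ^ 2 := by
  simp [Torus.freqNormSq, shearFreq, Fin.sum_univ_three]

/-- `neg_mem_shearSet` (bookkeeping for the shear-mode family). [folklore] -/
theorem neg_mem_shearSet (M : ℕ) : ∀ k ∈ shearSet M, -k ∈ shearSet M := by
  intro k hk
  simp only [shearSet, Finset.mem_insert, Finset.mem_singleton] at hk ⊢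
  rcases hk with rfl | rfl <;> simp

/-- `freqNormSq_of_mem_shearSet` (bookkeeping for the shear-mode family). [folklore] -/
theorem freqNormSq_of_mem_shearSet {M : ℕ} {k : Fin 3 → ℤ} (hk : k ∈ shearSet M) :
    Torus.freqNormSq k = (M : ℝ) ^ 2 := by
  simp only [shearSet, Finset.mem_insert, Finset.mem_singleton] at hk
  rcases hk with rfl | rfl
  · exact freqNormSq_shearFreq M
  · rw [Torus.freqNormSq_neg]; exact freqNormSq_shearFreq M

/-- `ne_zero_of_mem_shearSet` (bookkeeping for the shear-mode family). [folklore] -/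
theorem ne_zero_of_mem_shearSet {M : ℕ} (hM : M ≠ 0) {k : Fin 3 → ℤ} (hk : k ∈ shearSet M) : k ≠ 0 := by
  intro h; subst h
  have h1 := freqNormSq_of_mem_shearSet hk
  rw [Torus.freqNormSq_zero] at h1
  have : (M : ℝ) ≠ 0 := by exact_mod_cast hM
  exact this (pow_eq_zero_iff two_ne_zero |>.1 h1.symm)

/-- `apply_zero_of_mem_shearSet` (bookkeeping for the shear-mode family). [folklore] -/
theorem apply_zero_of_mem_shearSet {M : ℕ} {k : Fin 3 → ℤ} (hk : k ∈ shearSet M) : k 0 = 0 := by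
  simp only [shearSet, Finset.mem_insert, Finset.mem_singleton] at hk
  rcases hk with rfl | rfl <;> simp [shearFreq]

/-- `isTransversal_kolCoeff_shearSet` (bookkeeping for the shear-mode family). [folklore] -/
theorem isTransversal_kolCoeff_shearSet (M : ℕ) (a : ℝ) : Torus.IsTransversal (shearSet M) (kolCoeff a) := by
  intro k hk
  simp [kolCoeff, EuclideanSpace.complexify_apply, Fin.sum_univ_three, apply_zero_of_mem_shearSet hk]

/-- `K_{M,a}` is smooth. [folklore] -/
theorem isSmooth_shearField (M : ℕ) (a : ℝ) : Torus.IsSmooth (shearField M a) :=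
  Torus.isSmooth_realTrigPoly _ _

/-- `K_{M,a}` is divergence free. [folklore] -/
theorem isDivFree_shearField (M : ℕ) (a : ℝ) : Torus.IsDivFree (shearField M a) :=
  Torus.isDivFree_realTrigPoly (isTransversal_kolCoeff_shearSet M a)

/-- `K_{M,a}` has zero mean (`M ≠ 0`). [folklore] -/
theorem hasZeroMean_shearField {M : ℕ} (hM : M ≠ 0) (a : ℝ) : Torus.HasZeroMean (shearField M a) := by
  unfold Torus.HasZeroMean shearField
  simp_rw [Torus.realTrigPoly_apply_eq_sum]
  rw [integral_finsetSum _ fun k _ => ?_]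
  · refine Finset.sum_eq_zero fun k hk => ?_
    have hi : Integrable (fun x : UnitAddTorus (Fin 3) => UnitAddTorus.mFourier k x • kolCoeff a k) volume :=
      ((UnitAddTorus.mFourier k).continuous.smul continuous_const).integrable_unitAddTorus
    rw [ContinuousLinearMap.integral_comp_comm _ hi, integral_smul_const, Torus.integral_mFourier,
      if_neg (ne_zero_of_mem_shearSet hM hk), zero_smul, map_zero]
  · exact (EuclideanSpace.realPart.continuous.comp
      ((UnitAddTorus.mFourier k).continuous.smul continuous_const)).integrable_unitAddTorus

/-- `K_{M,ra} = r K_{M,a}`. [folklore] -/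
theorem shearField_mul (M : ℕ) (r a : ℝ) (x : T3) : shearField M (r * a) x = r • shearField M a x := by
  simp only [shearField, Torus.realTrigPoly_apply_eq_sum, kolCoeff_mul, Finset.smul_sum]
  refine Finset.sum_congr rfl fun k _ => ?_
  rw [← map_smul, smul_comm, Complex.coe_smul]

/-- `K_{M,0} = 0`. [folklore] -/
theorem shearField_zero (M : ℕ) : shearField M 0 = 0 := by
  have h : kolCoeff 0 = 0 := by funext k; simp [kolCoeff]
  rw [shearField, h, Torus.realTrigPoly_zero]

/-- `ΔK_{M,a} = −4π²M² K_{M,a}`. [folklore] -/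
theorem laplacian_shearField (M : ℕ) (a : ℝ) (x : T3) :
    Torus.laplacian (shearField M a) x = -(4 * Real.pi ^ 2 * (M : ℝ) ^ 2) • shearField M a x := by
  rw [shearField, Torus.laplacian_realTrigPoly, show -(4 * Real.pi ^ 2 * (M : ℝ) ^ 2) •
    Torus.realTrigPoly (shearSet M) (kolCoeff a) x = shearField M (-(4 * Real.pi ^ 2 * (M : ℝ) ^ 2) * a) x
    from (shearField_mul M _ _ x).symm, shearField]
  refine congrFun (Torus.realTrigPoly_congr fun k hk => ?_) x
  rw [kolCoeff_mul, freqNormSq_of_mem_shearSet hk]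
  simp

/-- `∂₀ K_{M,a} = 0`. [folklore] -/
theorem partialDeriv_zero_shearField (M : ℕ) (a : ℝ) : Torus.partialDeriv 0 (shearField M a) = 0 := by
  rw [shearField, Torus.partialDeriv_realTrigPoly', ← Torus.realTrigPoly_zero (shearSet M)]
  refine Torus.realTrigPoly_congr fun k hk => ?_
  simp [apply_zero_of_mem_shearSet hk]

/-- The components `i ≠ 0` of `K_{M,a}` vanish. [folklore] -/
theorem shearField_apply_of_ne (M : ℕ) (a : ℝ) (x : T3) {i : Fin 3} (hi : i ≠ 0) :
    shearField M a x i = 0 := by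
  rw [shearField, Torus.realTrigPoly_apply_coord, Torus.trigPoly_apply]
  simp [kolCoeff, EuclideanSpace.complexify_apply, hi.symm]

/-- `(K·∇)K = 0`: a parallel shear mode has no self-advection. [folklore] -/
theorem convect_shearField_self (M : ℕ) (a : ℝ) (x : T3) :
    Torus.convect (shearField M a) (shearField M a) x = 0 := by
  rw [Torus.convect, Torus.fderiv_apply_eq_sum_partialDeriv ((isSmooth_shearField M a).isContDiff (by simp))]
  refine Finset.sum_eq_zero fun i _ => ?_
  by_cases hi : i = 0
  · subst hi; rw [partialDeriv_zero_shearField]; simp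
  · rw [shearField_apply_of_ne M a x hi, zero_smul]

/-- The transport term of a shear mode vanishes against every smooth field: `∫ ⟪K, (K·∇)w⟫ = 0`
(`= −∫ ⟪(K·∇)K, w⟫ = 0`). [folklore] -/
theorem integral_inner_convect_shearField (M : ℕ) (a : ℝ) {w : T3 → R3} (hw : Torus.IsSmooth w) :
    ∫ x, ⟪shearField M a x, Torus.convect (shearField M a) w x⟫_ℝ = 0 := by
  have hK := isSmooth_shearField M a
  have h := Torus.integral_inner_convect_add_eq_zero hK (isDivFree_shearField M a) hK hw
  have h0 : ∫ x, ⟪Torus.convect (shearField M a) (shearField M a) x, w x⟫_ℝ = 0 := by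
    simp_rw [convect_shearField_self, inner_zero_left, integral_zero]
  linarith

/-- `∫ ⟪K_{M,a}, Δw⟫ = −4π²M² ∫ ⟪K_{M,a}, w⟫` for smooth `w`. [folklore] -/
theorem integral_inner_laplacian_shearField (M : ℕ) (a : ℝ) {w : T3 → R3} (hw : Torus.IsSmooth w) :
    ∫ x, ⟪shearField M a x, Torus.laplacian w x⟫_ℝ =
      -(4 * Real.pi ^ 2 * (M : ℝ) ^ 2) * ∫ x, ⟪shearField M a x, w x⟫_ℝ := by
  rw [← Torus.integral_inner_laplacian_comm (isSmooth_shearField M a) hw]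
  simp_rw [laplacian_shearField, inner_smul_left]
  rw [integral_const_mul]
  simp

/-- **`K_{M,a}` is an exact steady state of (Galerkin) NS at force `4π²νM² K_{M,a}`**: `⟨F(U), w⟩ = 0`
for EVERY smooth `w` (so for every truncation's tests), `U` the class of `K_{M,a}`. [folklore] -/
theorem nsGeneratorPairing_shearField {M : ℕ} {ν a : ℝ} {U : H3}
    (hU : ((U.1 : L2T3) : T3 → R3) =ᵐ[volume] shearField M a) {w : T3 → R3} (hw : Torus.IsSmooth w) :
    Torus.nsGeneratorPairing ν (shearField M (4 * Real.pi ^ 2 * ν * (M : ℝ) ^ 2 * a)) U w = 0 := by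
  have hK := isSmooth_shearField M a
  have hf := isSmooth_shearField M (4 * Real.pi ^ 2 * ν * (M : ℝ) ^ 2 * a)
  rw [Torus.nsGeneratorPairing_eq_flux ν (hf.memLp 2) hw hU]
  have hi1 : Integrable (fun x => ⟪shearField M a x, Torus.convect (shearField M a) w x⟫_ℝ) volume :=
    (hK.continuous.inner (hK.convect hw).continuous).integrable_unitAddTorus
  have hi2 : Integrable (fun x => ν * ⟪shearField M a x, Torus.laplacian w x⟫_ℝ) volume :=
    ((hK.continuous.inner hw.laplacian.continuous).integrable_unitAddTorus).const_mul ν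
  have hi3 : Integrable (fun x => ⟪shearField M (4 * Real.pi ^ 2 * ν * (M : ℝ) ^ 2 * a) x, w x⟫_ℝ) volume :=
    (hf.continuous.inner hw.continuous).integrable_unitAddTorus
  have hi12 : Integrable (fun x => ⟪shearField M a x, Torus.convect (shearField M a) w x⟫_ℝ +
      ν * ⟪shearField M a x, Torus.laplacian w x⟫_ℝ) volume := hi1.add hi2
  rw [integral_add hi12 hi3, integral_add hi1 hi2, integral_const_mul,
    integral_inner_convect_shearField M a hw, integral_inner_laplacian_shearField M a hw]
  have h3 : ∫ x, ⟪shearField M (4 * Real.pi ^ 2 * ν * (M : ℝ) ^ 2 * a) x, w x⟫_ℝ =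
      (4 * Real.pi ^ 2 * ν * (M : ℝ) ^ 2) * ∫ x, ⟪shearField M a x, w x⟫_ℝ := by
    simp_rw [shearField_mul, inner_smul_left]
    rw [integral_const_mul]
    simp
  rw [h3]
  ring

/-- **Free shear modes are steady for Euler**: at `ν = 0` and zero force, `⟨F(U), w⟩ = 0` for every
smooth `w` (the class `U` of ANY `K_{M,a}`). [folklore] -/
theorem nsGeneratorPairing_shearField_euler {M : ℕ} {a : ℝ} {U : H3}
    (hU : ((U.1 : L2T3) : T3 → R3) =ᵐ[volume] shearField M a) {w : T3 → R3} (hw : Torus.IsSmooth w) :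
    Torus.nsGeneratorPairing 0 (0 : T3 → R3) U w = 0 := by
  have h := nsGeneratorPairing_shearField (ν := 0) hU hw
  simpa [shearField_zero] using h

/-- **A decaying shear mode is invisible below its shell**: at zero force and ANY viscosity,
`⟨F(U), w⟩ = ν (K_{M,a}, Δw) = −4π²M²ν (K_{M,a}, w) = 0` for every smooth `w` without the modes `±M e₁`. [folklore] -/
theorem nsGeneratorPairing_shearField_of_coeff_eq_zero {M : ℕ} {ν a : ℝ} {U : H3}
    (hU : ((U.1 : L2T3) : T3 → R3) =ᵐ[volume] shearField M a) {w : T3 → R3} (hw : Torus.IsSmooth w)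
    (hw0 : ∀ k ∈ shearSet M, UnitAddTorus.mFourierCoeff (EuclideanSpace.complexify ∘ w) k = 0) :
    Torus.nsGeneratorPairing ν (0 : T3 → R3) U w = 0 := by
  have hK := isSmooth_shearField M a
  have hf0 : MemLp (0 : T3 → R3) 2 volume := (Torus.isSmooth_const (0 : R3)).memLp 2
  rw [Torus.nsGeneratorPairing_eq_flux ν hf0 hw hU]
  have hi1 : Integrable (fun x => ⟪shearField M a x, Torus.convect (shearField M a) w x⟫_ℝ) volume :=
    (hK.continuous.inner (hK.convect hw).continuous).integrable_unitAddTorus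
  have hi2 : Integrable (fun x => ν * ⟪shearField M a x, Torus.laplacian w x⟫_ℝ) volume :=
    ((hK.continuous.inner hw.laplacian.continuous).integrable_unitAddTorus).const_mul ν
  have hi3 : Integrable (fun x => ⟪(0 : T3 → R3) x, w x⟫_ℝ) volume := by simp
  have hi12 : Integrable (fun x => ⟪shearField M a x, Torus.convect (shearField M a) w x⟫_ℝ +
      ν * ⟪shearField M a x, Torus.laplacian w x⟫_ℝ) volume := hi1.add hi2
  rw [integral_add hi12 hi3, integral_add hi1 hi2, integral_const_mul,
    integral_inner_convect_shearField M a hw, integral_inner_laplacian_shearField M a hw,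
    shearField, Torus.integral_inner_realTrigPoly_left (neg_mem_shearSet M) (isConjSymm_kolCoeff a)
      (hw.memLp 2), Finset.sum_eq_zero fun k hk => by rw [hw0 k hk, inner_zero_right, Complex.zero_re]]
  simp

/-- `shearFreq M ≠ -shearFreq M` (`M ≠ 0`). [folklore] -/
theorem shearFreq_ne_neg {M : ℕ} (hM : M ≠ 0) : shearFreq M ≠ -shearFreq M := fun h => by
  have := congrFun h 1
  simp [shearFreq] at this
  omega

/-- `card_shearSet` (bookkeeping for the shear-mode family). [folklore] -/
theorem card_shearSet {M : ℕ} (hM : M ≠ 0) : (shearSet M).card = 2 := by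
  rw [shearSet, Finset.card_insert_of_notMem (by simpa using shearFreq_ne_neg hM), Finset.card_singleton]

/-- `‖∇K_{M,a}‖² = 2π²M²a²` (all of it on the shell `|k| = M`), in `ℝ≥0∞`. [folklore] -/
theorem eGradNormSq_shearField {M : ℕ} (hM : M ≠ 0) (a : ℝ) :
    Torus.eGradNormSq (shearField M a) = ENNReal.ofReal (2 * Real.pi ^ 2 * (M : ℝ) ^ 2 * a ^ 2) := by
  rw [shearField, Torus.eGradNormSq_realTrigPoly (neg_mem_shearSet M) (isConjSymm_kolCoeff a),
    Finset.sum_congr rfl fun k hk => by rw [freqNormSq_of_mem_shearSet hk, norm_kolCoeff],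
    Finset.sum_const, card_shearSet hM]
  congr 1
  simp only [nsmul_eq_mul, Nat.cast_ofNat, div_pow, sq_abs]
  ring

/-- `∫ ‖K_{M,a}‖² = a²/2` (independent of `M`). [folklore] -/
theorem integral_norm_sq_shearField {M : ℕ} (hM : M ≠ 0) (a : ℝ) : ∫ x, ‖shearField M a x‖ ^ 2 = a ^ 2 / 2 := by
  rw [shearField, Torus.integral_norm_sq_realTrigPoly (neg_mem_shearSet M) (isConjSymm_kolCoeff a),
    Finset.sum_congr rfl fun k _ => by rw [norm_kolCoeff], Finset.sum_const, card_shearSet hM]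
  simp only [nsmul_eq_mul, Nat.cast_ofNat, div_pow, sq_abs]
  ring

/-- Fourier coefficients of `K_{M,a}` vanish off `{±M e₁}`. [folklore] -/
theorem mFourierCoeff_shearField_eq_zero {M : ℕ} (a : ℝ) {k : Fin 3 → ℤ} (hk : k ∉ shearSet M) :
    UnitAddTorus.mFourierCoeff (EuclideanSpace.complexify ∘ shearField M a) k = 0 :=
  Torus.mFourierCoeff_realTrigPoly_eq_zero (neg_mem_shearSet M) (isConjSymm_kolCoeff a) hk

/-- **Below the shell the truncation sees nothing**: `P_K K_{M,a} = 0` for `K < M`. [folklore] -/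
theorem fourierTruncate_shearField {K M : ℕ} (hKM : K < M) (a : ℝ) :
    Torus.fourierTruncate K (shearField M a) = 0 := by
  rw [Torus.fourierTruncate, ← Torus.realTrigPoly_zero (Torus.freqBall K)]
  refine Torus.realTrigPoly_congr fun k hk => ?_
  refine mFourierCoeff_shearField_eq_zero a fun hkS => ?_
  have h1 : Torus.freqNormSq k ≤ (K : ℝ) ^ 2 := Torus.mem_freqBall.1 hk
  rw [freqNormSq_of_mem_shearSet hkS] at h1
  have h2 : (K : ℝ) < M := by exact_mod_cast hKM
  nlinarith [h2, (Nat.cast_nonneg K : (0 : ℝ) ≤ K)]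

/-- The spectral enstrophy of the zero field is `0`. [folklore] -/
theorem eGradNormSq_zero : Torus.eGradNormSq (0 : T3 → R3) = 0 := by
  rw [← Torus.realTrigPoly_zero (∅ : Finset (Fin 3 → ℤ)),
    Torus.eGradNormSq_realTrigPoly (by simp) Torus.isConjSymm_zero]
  simp

/-- Truncation only sees the a.e. class. [folklore] -/
theorem fourierTruncate_congr_ae {v w : T3 → R3} (h : v =ᵐ[volume] w) (K : ℕ) :
    Torus.fourierTruncate K v = Torus.fourierTruncate K w := by
  rw [Torus.fourierTruncate, Torus.fourierTruncate]
  congr 1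
  funext k
  exact mFourierCoeff_congr_ae h k

/-- The class of `K_{M,a}` in `H`. [folklore] -/
def shearState (M : ℕ) (hM : M ≠ 0) (a : ℝ) : H3 :=
  ⟨((isSmooth_shearField M a).memLp 2).toLp (shearField M a),
    Torus.smoothSolenoidal_subset_energySpace ⟨shearField M a, isSmooth_shearField M a,
      isDivFree_shearField M a, hasZeroMean_shearField hM a, MemLp.coeFn_toLp _⟩⟩

/-- `coe_shearState_ae` (bookkeeping for the shear-mode family). [folklore] -/
theorem coe_shearState_ae {M : ℕ} (hM : M ≠ 0) (a : ℝ) :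
    (((shearState M hM a).1 : L2T3) : T3 → R3) =ᵐ[volume] shearField M a :=
  MemLp.coeFn_toLp ((isSmooth_shearField M a).memLp 2)

/-- `K_{M,a}` is a level-`N` field for every `N ≥ M`. [folklore] -/
theorem isLevel_shearState {M : ℕ} (hM : M ≠ 0) (a : ℝ) {N : ℕ} (hMN : M ≤ N) :
    IsLevel N (shearState M hM a) := by
  intro k hk
  rw [mFourierCoeff_congr_ae (coe_shearState_ae hM a)]
  refine mFourierCoeff_shearField_eq_zero a fun hkS => hk (Finset.mem_erase.2 ⟨ne_zero_of_mem_shearSet hM hkS,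
    Torus.mem_freqBall.2 ?_⟩)
  rw [freqNormSq_of_mem_shearSet hkS]
  have : (M : ℝ) ≤ N := by exact_mod_cast hMN
  nlinarith

/-- `‖[K_{M,a}]‖²_H = a²/2`. [folklore] -/
theorem norm_sq_shearState {M : ℕ} (hM : M ≠ 0) (a : ℝ) : ‖shearState M hM a‖ ^ 2 = a ^ 2 / 2 := by
  have h : ‖shearState M hM a‖ = ‖((shearState M hM a).1 : L2T3)‖ := rfl
  rw [h, ← Torus.integral_norm_sq_coe_eq, ← integral_norm_sq_shearField hM a]
  exact integral_congr_ae ((coe_shearState_ae hM a).mono fun x hx => by simp [hx])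

/-- `‖[K_{M,1}]‖_H ≤ 1`. [folklore] -/
theorem norm_shearState_one_le {M : ℕ} (hM : M ≠ 0) : ‖shearState M hM 1‖ ≤ 1 := by
  have h := norm_sq_shearState hM 1
  nlinarith [norm_nonneg (shearState M hM 1)]

/-- Enstrophy of the class: `‖∇[K_{M,a}]‖² = 2π²M²a²`. [folklore] -/
theorem eGradNormSq_shearState {M : ℕ} (hM : M ≠ 0) (a : ℝ) :
    Torus.eGradNormSq (((shearState M hM a).1 : L2T3) : T3 → R3) =
      ENNReal.ofReal (2 * Real.pi ^ 2 * (M : ℝ) ^ 2 * a ^ 2) := by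
  rw [eGradNormSq_congr_ae (coe_shearState_ae hM a), eGradNormSq_shearField hM]

/-- Below the shell, the truncated enstrophy of the class vanishes. [folklore] -/
theorem eGradNormSq_fourierTruncate_shearState {K M : ℕ} (hM : M ≠ 0) (hKM : K < M) (a : ℝ) :
    Torus.eGradNormSq (Torus.fourierTruncate K (((shearState M hM a).1 : L2T3) : T3 → R3)) = 0 := by
  rw [fourierTruncate_congr_ae (coe_shearState_ae hM a), fourierTruncate_shearField hKM, eGradNormSq_zero]


/-! ## §2 Load-bearing hypotheses: each of `0 < ν`, stationarity, the level clause is NECESSARY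

Witness for all three: the Dirac law at the shear mode one shell above the first cutoff `κ 0`. -/

section LoadBearing

/-- Constant fields are divergence free. [folklore] -/
theorem isDivFree_const (a : R3) : Torus.IsDivFree (fun _ : T3 => a) := by
  intro x
  simp [Torus.divergence, Torus.partialDeriv, Torus.lineDeriv]

/-- The zero force is divergence free. [folklore] -/
theorem isDivFree_zero : Torus.IsDivFree (0 : T3 → R3) := isDivFree_const (0 : R3)

/-- The zero force is smooth. [folklore] -/
theorem isSmooth_zero : Torus.IsSmooth (0 : T3 → R3) := Torus.isSmooth_const (0 : R3)

/-- The zero force has zero mean. [folklore] -/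
theorem hasZeroMean_zero : Torus.HasZeroMean (0 : T3 → R3) := by
  simp [Torus.HasZeroMean]

/-- Frequencies with `N² < |k|²` are off the punctured ball of radius `N`. [folklore] -/
theorem not_mem_puncturedBall_of_lt {N : ℕ} {k : Fin 3 → ℤ} (hk : ((N : ℝ)) ^ 2 < Torus.freqNormSq k) :
    k ∉ (Torus.freqBall N).erase (0 : Fin 3 → ℤ) := fun h =>
  absurd (Torus.mem_freqBall.1 (Finset.mem_erase.1 h).2) (not_le.2 hk)

/-- The modes `±M e₁` are off the punctured ball of every radius `N < M`. [folklore] -/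
theorem not_mem_puncturedBall_of_mem_shearSet {N M : ℕ} (hNM : N < M) {k : Fin 3 → ℤ} (hk : k ∈ shearSet M) :
    k ∉ (Torus.freqBall N).erase (0 : Fin 3 → ℤ) := by
  refine not_mem_puncturedBall_of_lt ?_
  rw [freqNormSq_of_mem_shearSet hk]
  have : (N : ℝ) < M := by exact_mod_cast hNM
  nlinarith [(Nat.cast_nonneg N : (0 : ℝ) ≤ N)]

/-- **Band-limited fields are closed under finite linear combinations** (coefficientwise): if every
`ĝᵢ(k) = 0` then `𝓕(Σᵢ cᵢ gᵢ)(k) = 0`. [folklore] -/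
theorem mFourierCoeff_sum_smul_eq_zero {m : ℕ} {g : Fin m → T3 → R3} (hg : ∀ i, Torus.IsSmooth (g i))
    (c : Fin m → ℝ) {k : Fin 3 → ℤ}
    (hk : ∀ i, UnitAddTorus.mFourierCoeff (EuclideanSpace.complexify ∘ g i) k = 0) :
    UnitAddTorus.mFourierCoeff (EuclideanSpace.complexify ∘ fun x => ∑ i, c i • g i x) k = 0 := by
  have h1 : (EuclideanSpace.complexify ∘ fun x => ∑ i, c i • g i x) =
      fun x => ∑ i, (((c i : ℝ) : ℂ) • (EuclideanSpace.complexify ∘ g i)) x := by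
    funext x
    simp only [Function.comp_apply, map_sum, LinearIsometry.map_smul, Pi.smul_apply, Complex.coe_smul]
  rw [h1, Torus.mFourierCoeff_finset_sum _ fun i _ =>
    ((EuclideanSpace.complexify.continuous.comp (hg i).continuous).const_smul ((c i : ℝ) : ℂ)).integrable_unitAddTorus]
  refine Finset.sum_eq_zero fun i _ => ?_
  rw [Torus.mFourierCoeff_const_smul, hk i, smul_zero]

/-- The differential field `∇p(u)` of a polynomial observable with level-`N` band tests has no mode off
the punctured ball. [folklore] -/
theorem mFourierCoeff_polyGrad_eq_zero {N m : ℕ} {g : Fin m → T3 → R3} (hg : ∀ i, IsBandTest N (g i))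
    (P : MvPolynomial (Fin m) ℝ) (u : H3) {k : Fin 3 → ℤ} (hk : k ∉ (Torus.freqBall N).erase (0 : Fin 3 → ℤ)) :
    UnitAddTorus.mFourierCoeff (EuclideanSpace.complexify ∘ polyGrad g P u) k = 0 :=
  mFourierCoeff_sum_smul_eq_zero (fun i => (hg i).1) _ fun i => (hg i).2.2.2 k hk

/-- **The free shear Dirac is stationary for Galerkin EULER at every level** (`ν = 0`, `f = 0`). [folklore] -/
theorem isStationary_dirac_shearState_euler {M : ℕ} (hM : M ≠ 0) (a : ℝ) (N : ℕ) :
    IsStationary 0 0 N (Measure.dirac (shearState M hM a)) := by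
  haveI : MeasurableSingletonClass H3 := OpensMeasurableSpace.toMeasurableSingletonClass
  intro m g P hg
  refine ⟨Torus.integrable_dirac _ _, ?_⟩
  rw [integral_dirac]
  exact nsGeneratorPairing_shearField_euler (coe_shearState_ae hM a)
    (Torus.isSmooth_sum_smul Finset.univ _ fun i _ => (hg i).1)

/-- **The decaying shear Dirac above the level is stationary at zero force, ANY viscosity**: for `N < M`
no level-`N` observable sees the mode `K_{M,a}` (`δ_{K_{M,a}}` is NOT invariant for `ν > 0` — it decays —
but it is invisible: the level clause on `μ` is what ties the law to the tests). [folklore] -/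
theorem isStationary_dirac_shearState_of_lt {M : ℕ} (hM : M ≠ 0) (a ν : ℝ) {N : ℕ} (hNM : N < M) :
    IsStationary ν 0 N (Measure.dirac (shearState M hM a)) := by
  haveI : MeasurableSingletonClass H3 := OpensMeasurableSpace.toMeasurableSingletonClass
  intro m g P hg
  refine ⟨Torus.integrable_dirac _ _, ?_⟩
  rw [integral_dirac]
  exact nsGeneratorPairing_shearField_of_coeff_eq_zero (coe_shearState_ae hM a)
    (Torus.isSmooth_sum_smul Finset.univ _ fun i _ => (hg i).1)
    fun k hk => mFourierCoeff_polyGrad_eq_zero hg P _ (not_mem_puncturedBall_of_mem_shearSet hNM hk)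

/-- The Dirac law at `K_{M,a}` is carried by level-`N` fields, `M ≤ N`. [folklore] -/
theorem ae_isLevel_dirac_shearState {M : ℕ} (hM : M ≠ 0) (a : ℝ) {N : ℕ} (hMN : M ≤ N) :
    ∀ᵐ u ∂(Measure.dirac (shearState M hM a)), IsLevel N u := by
  haveI : MeasurableSingletonClass H3 := OpensMeasurableSpace.toMeasurableSingletonClass
  rw [ae_dirac_eq]
  simpa using isLevel_shearState hM a hMN

/-- The Dirac law at `K_{M,1}` is supported in the unit ball of `H`. [folklore] -/
theorem ae_norm_le_dirac_shearState {M : ℕ} (hM : M ≠ 0) :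
    ∀ᵐ u ∂(Measure.dirac (shearState M hM 1)), ‖u‖ ≤ (1 : ℝ) := by
  haveI : MeasurableSingletonClass H3 := OpensMeasurableSpace.toMeasurableSingletonClass
  rw [ae_dirac_eq]
  simpa using norm_shearState_one_le hM

/-- **The common contradiction.** The Dirac law at the shear mode ONE SHELL ABOVE `κ 0` is not
`κ`-resolved at tolerance `1` (`n = 0`): its enstrophy `2π²(κ 0 + 1)² ≥ 2π² > 1` lies entirely above the
cutoff `κ 0`, where the truncated enstrophy is `0`. [folklore] -/
theorem not_isResolved_dirac_shearState (κ : ℕ → ℕ) :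
    ¬ IsResolved κ (Measure.dirac (shearState (κ 0 + 1) (Nat.succ_ne_zero _) 1)) 0 := by
  haveI : MeasurableSingletonClass H3 := OpensMeasurableSpace.toMeasurableSingletonClass
  intro h
  unfold IsResolved at h
  rw [lintegral_dirac, lintegral_dirac, eGradNormSq_shearState,
    eGradNormSq_fourierTruncate_shearState _ (Nat.lt_succ_self _)] at h
  simp only [Nat.cast_zero, zero_add, inv_one, one_pow, mul_one, ENNReal.ofReal_le_one] at h
  push_cast at h
  have hpi : (9 : ℝ) < Real.pi ^ 2 := by nlinarith [Real.pi_gt_three]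
  nlinarith [(Nat.cast_nonneg (κ 0) : (0 : ℝ) ≤ κ 0), sq_nonneg ((κ 0 : ℝ))]

/-- **`0 < ν` is load-bearing.** At `ν = 0` (Galerkin Euler, `f = 0`, `R = 1`) every shear mode
`K_{M,1}` is an exact steady state at every level `N ≥ M`, with energy `1/2` and enstrophy `2π²M²` on the
shell `M`: no schedule resolves `δ_{K_{κ 0 + 1, 1}}`. (Physically: no viscosity, no dissipation scale.)
(The refuted statement — WEAKENING 1 — `ResolvedDissipation` with `0 < ν` weakened to `0 ≤ ν` (all else verbatim).) [folklore] -/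
theorem resolvedDissipation_false_without_nu_pos :
    ¬ (∀ f : T3 → R3, Torus.IsSmooth f → Torus.IsDivFree f → Torus.HasZeroMean f →
        ∀ ν : ℝ, 0 ≤ ν → ∀ R : ℝ, ∃ κ : ℕ → ℕ, ∀ (N : ℕ) (μ : Measure H3), IsProbabilityMeasure μ →
          (∀ᵐ u ∂μ, IsLevel N u) → (∀ᵐ u ∂μ, ‖u‖ ≤ R) → IsStationary ν f N μ → ∀ n, IsResolved κ μ n) := by
  intro h
  obtain ⟨κ, hκ⟩ := h 0 isSmooth_zero isDivFree_zero hasZeroMean_zero 0 le_rfl 1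
  exact not_isResolved_dirac_shearState κ (hκ (κ 0 + 1) _ inferInstance
    (ae_isLevel_dirac_shearState _ 1 le_rfl) (ae_norm_le_dirac_shearState _)
    (isStationary_dirac_shearState_euler _ 1 _) 0)

/-- **Stationarity is load-bearing.** Without it, `δ_{K_{κ 0 + 1, 1}}` (level `κ 0 + 1`, unit ball) is an
admissible law at `ν = 1`, unresolved. A proof must use the invariance of `μ` under the Galerkin flow
(the only hypothesis linking `μ` to `ν` and `f`).
(The refuted statement — WEAKENING 2 — `ResolvedDissipation` without the stationarity hypothesis (all else verbatim).) [folklore] -/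
theorem resolvedDissipation_false_without_stationarity :
    ¬ (∀ f : T3 → R3, Torus.IsSmooth f → Torus.IsDivFree f → Torus.HasZeroMean f →
        ∀ ν : ℝ, 0 < ν → ∀ R : ℝ, ∃ κ : ℕ → ℕ, ∀ (N : ℕ) (μ : Measure H3), IsProbabilityMeasure μ →
          (∀ᵐ u ∂μ, IsLevel N u) → (∀ᵐ u ∂μ, ‖u‖ ≤ R) → ∀ n, IsResolved κ μ n) := by
  intro h
  obtain ⟨κ, hκ⟩ := h 0 isSmooth_zero isDivFree_zero hasZeroMean_zero 1 one_pos 1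
  exact not_isResolved_dirac_shearState κ (hκ (κ 0 + 1) _ inferInstance
    (ae_isLevel_dirac_shearState _ 1 le_rfl) (ae_norm_le_dirac_shearState _) 0)

/-- **The level clause is load-bearing.** Without it the law may live above the tests: at `ν = 1`,
`f = 0`, level `N = 0` (or any `N ≤ κ 0`), the decaying mode `δ_{K_{κ 0 + 1, 1}}` passes every level-`N`
row (it is invisible to them) and is unresolved. So a proof must use that `μ` is carried by the SAME
Galerkin space the tests generate (stationarity for band-limited tests = Liouville only on level-`N` laws).
(The refuted statement — WEAKENING 3 — `ResolvedDissipation` without the level clause `∀ᵐ u ∂μ, û = 0 off 0 < |k| ≤ N` on the law (the tests stay band-limited at level `N`; all else verbatim).) [folklore] -/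
theorem resolvedDissipation_false_without_level :
    ¬ (∀ f : T3 → R3, Torus.IsSmooth f → Torus.IsDivFree f → Torus.HasZeroMean f →
        ∀ ν : ℝ, 0 < ν → ∀ R : ℝ, ∃ κ : ℕ → ℕ, ∀ (N : ℕ) (μ : Measure H3), IsProbabilityMeasure μ →
          (∀ᵐ u ∂μ, ‖u‖ ≤ R) → IsStationary ν f N μ → ∀ n, IsResolved κ μ n) := by
  intro h
  obtain ⟨κ, hκ⟩ := h 0 isSmooth_zero isDivFree_zero hasZeroMean_zero 1 one_pos 1
  exact not_isResolved_dirac_shearState κ (hκ 0 _ inferInstance (ae_norm_le_dirac_shearState _)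
    (isStationary_dirac_shearState_of_lt _ 1 1 (Nat.succ_pos _)) 0)

end LoadBearing

/-! ## §3 The quantifier order is the whole content: `∀ N ∃ κ` is free (`κ ≡ N`) -/

section Levelwise

/-- On a level-`N` field the truncation `P_N` loses no enstrophy: `‖∇P_N u‖² = ‖∇u‖²`
(`𝓕(P_N u) = û` on the ball, and `û = 0` off it). [folklore] -/
theorem eGradNormSq_fourierTruncate_of_isLevel {N : ℕ} {u : H3} (hu : IsLevel N u) :
    Torus.eGradNormSq (Torus.fourierTruncate N ((u.1 : L2T3) : T3 → R3)) =
      Torus.eGradNormSq ((u.1 : L2T3) : T3 → R3) := by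
  have hint : Integrable ((u.1 : L2T3) : T3 → R3) volume := (Lp.memLp (u.1 : L2T3)).integrable one_le_two
  rw [Torus.eGradNormSq_eq_tsum, Torus.eGradNormSq_eq_tsum]
  congr 1
  refine tsum_congr fun k => ?_
  rw [Torus.mFourierCoeff_fourierTruncate hint N k]
  by_cases hk : k ∈ Torus.freqBall N
  · rw [if_pos hk]
  · rw [if_neg hk, hu k fun h => hk (Finset.mem_of_mem_erase h)]

/-- **The levelwise statement is trivial** (`κ ≡ N`, exact resolution, no stationarity / support / viscosity
used): all the content of the crux is the UNIFORMITY of one schedule over all levels `N → ∞`.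
(The statement proved — WEAKENING 4 (quantifier swap) — `ResolvedDissipation` with `∃ κ ∀ N` weakened to `∀ N ∃ κ`.) [folklore] -/
theorem resolvedDissipationLevelwise_holds :
    ∀ f : T3 → R3, Torus.IsSmooth f → Torus.IsDivFree f → Torus.HasZeroMean f →
        ∀ ν : ℝ, 0 < ν → ∀ R : ℝ, ∀ N : ℕ, ∃ κ : ℕ → ℕ, ∀ μ : Measure H3, IsProbabilityMeasure μ →
          (∀ᵐ u ∂μ, IsLevel N u) → (∀ᵐ u ∂μ, ‖u‖ ≤ R) → IsStationary ν f N μ → ∀ n, IsResolved κ μ n := by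
  intro f _ _ _ ν _ R N
  refine ⟨fun _ => N, fun μ _ hlev _ _ n => ?_⟩
  unfold IsResolved
  rw [lintegral_congr_ae (hlev.mono fun u hu => (eGradNormSq_fourierTruncate_of_isLevel hu).symm)]
  exact le_self_add

end Levelwise


/-! ## §4 Refuted strengthening: the schedule cannot be uniform in the force

`κ` depends on `f` through its spectral support, not through `ν`, `R` or an energy budget: the laminar
single-mode steady states `K_{M,1}` (force `4π²νM² K_{M,1}`, energy `1/2`, unit ball) carry enstrophy
`2π²M²` on the shell `M`, for every `M`. -/

section UniformInForce

/-- The laminar Dirac `δ_{K_{M,a}}` is stationary at EVERY level for the force `4π²νM² K_{M,a}`. [folklore] -/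
theorem isStationary_dirac_shearState_laminar {M : ℕ} (hM : M ≠ 0) (a ν : ℝ) (N : ℕ) :
    IsStationary ν (shearField M (4 * Real.pi ^ 2 * ν * (M : ℝ) ^ 2 * a)) N (Measure.dirac (shearState M hM a)) := by
  haveI : MeasurableSingletonClass H3 := OpensMeasurableSpace.toMeasurableSingletonClass
  intro m g P hg
  refine ⟨Torus.integrable_dirac _ _, ?_⟩
  rw [integral_dirac]
  exact nsGeneratorPairing_shearField (coe_shearState_ae hM a)
    (Torus.isSmooth_sum_smul Finset.univ _ fun i _ => (hg i).1)

/-- **No force-uniform schedule** (`ν = 1`, `R = 1`): given `κ`, the force `4π²M² K_{M,1}` with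
`M = κ 0 + 1` has the unresolved invariant law `δ_{K_{M,1}}` at level `M`. The schedule of the crux must
see the spectral tail of `f` (here: of `P_N f`), not just `‖f‖`, `ν`, `R`.
(The refuted statement — STRENGTHENING 1 — one schedule for ALL smooth forces at fixed `(ν, R)` (`∃ κ` moved before `∀ f`).) [folklore] -/
theorem not_resolvedDissipationUniformInForce :
    ¬ (∀ ν : ℝ, 0 < ν → ∀ R : ℝ, ∃ κ : ℕ → ℕ, ∀ f : T3 → R3, Torus.IsSmooth f → Torus.IsDivFree f →
        Torus.HasZeroMean f → ∀ (N : ℕ) (μ : Measure H3), IsProbabilityMeasure μ →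
          (∀ᵐ u ∂μ, IsLevel N u) → (∀ᵐ u ∂μ, ‖u‖ ≤ R) → IsStationary ν f N μ → ∀ n, IsResolved κ μ n) := by
  intro h
  obtain ⟨κ, hκ⟩ := h 1 one_pos 1
  have hM : κ 0 + 1 ≠ 0 := Nat.succ_ne_zero _
  exact not_isResolved_dirac_shearState κ (hκ _ (isSmooth_shearField _ _) (isDivFree_shearField _ _)
    (hasZeroMean_shearField hM _) (κ 0 + 1) _ inferInstance (ae_isLevel_dirac_shearState _ 1 le_rfl)
    (ae_norm_le_dirac_shearState _) (isStationary_dirac_shearState_laminar hM 1 1 _) 0)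

end UniformInForce


/-! ## §5 Kill shape: what a disproof must exhibit (pure logic)

`¬ResolvedDissipation` ⟺ ONE force/viscosity/radius and ONE tolerance `1/(n+1)` such that for EVERY cutoff
`K` some invariant level-`N` law in the ball keeps mean enstrophy `> 1/(n+1)` above `K` — necessarily at levels
`N > K` escaping to infinity (at `N ≤ K` the truncation is exact, §3). This is the "enstrophy leakage at
fixed `ν`" of the findings: its weak-* limit points are stationary statistical solutions with STRICT mean
energy inequality. -/

section KillShape

/-- **Kill shape** (`∀ κ ∃ (N, μ, n)` ⟺ `∃ n ∀ K ∃ (N, μ)`, by choice): a disproof of the crux is exactly a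
fixed-`ν` family of invariant Galerkin laws in a common ball leaking a fixed amount of enstrophy past every
cutoff.
(The right-hand side is the KILL SHAPE — The shape of a kill: a fixed `(f, ν, R, n)` and, for every cutoff `K`, an unresolved invariant law.) [folklore] -/
theorem not_resolvedDissipation_iff_killShape :
    ¬ ResolvedDissipation ↔
      ∃ f : T3 → R3, Torus.IsSmooth f ∧ Torus.IsDivFree f ∧ Torus.HasZeroMean f ∧
          ∃ ν : ℝ, 0 < ν ∧ ∃ (R : ℝ) (n : ℕ), ∀ K : ℕ, ∃ (N : ℕ) (μ : Measure H3), IsProbabilityMeasure μ ∧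
            (∀ᵐ u ∂μ, IsLevel N u) ∧ (∀ᵐ u ∂μ, ‖u‖ ≤ R) ∧ IsStationary ν f N μ ∧ ¬ IsResolved (fun _ => K) μ n := by
  rw [resolvedDissipation_iff]
  constructor
  · intro h
    push Not at h
    obtain ⟨f, hf, hd, hz, ν, hν, R, hR⟩ := h
    refine ⟨f, hf, hd, hz, ν, hν, R, ?_⟩
    by_contra hcon
    push Not at hcon
    choose Kf hK using hcon
    obtain ⟨N, μ, hp, hl, hn, hs, n, hres⟩ := hR Kf
    exact hres (hK n N μ hp hl hn hs)
  · rintro ⟨f, hf, hd, hz, ν, hν, R, n, hK⟩ h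
    obtain ⟨κ, hκ⟩ := h f hf hd hz ν hν R
    obtain ⟨N, μ, hp, hl, hn, hs, hres⟩ := hK (κ n)
    exact hres (hκ N μ hp hl hn hs n)

/-- In a kill, the unresolved laws live at levels ABOVE the cutoff: a level-`N` law with `N ≤ K` is
`K`-resolved at every tolerance (the truncation `P_K ⊇ P_N` is exact on it). [folklore] -/
theorem isResolved_const_of_level_le {K N : ℕ} (hNK : N ≤ K) {μ : Measure H3} (hlev : ∀ᵐ u ∂μ, IsLevel N u)
    (n : ℕ) : IsResolved (fun _ => K) μ n := by
  have hlevK : ∀ᵐ u ∂μ, IsLevel K u := hlev.mono fun u hu k hk => hu k fun h =>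
    hk (Finset.mem_erase.2 ⟨(Finset.mem_erase.1 h).1, Torus.freqBall_mono hNK (Finset.mem_erase.1 h).2⟩)
  unfold IsResolved
  rw [lintegral_congr_ae (hlevK.mono fun u hu => (eGradNormSq_fourierTruncate_of_isLevel hu).symm)]
  exact le_self_add

end KillShape


/-! ## §6 The known `N`-uniform input: the energy row bounds the quantity to be resolved

For every law admitted by the crux, `ν ∫‖∇u‖² dμ = ∫ (u,f) dμ ≤ ‖f‖₂ R` (the energy row of
`CubicParityLoud/Negative/EnergyRow` — the admissible quadratic test `Σ_a (u,e_a)²` over the Galerkin frame —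
plus Cauchy–Schwarz): the mean enstrophy `∫⁻ ‖∇u‖² dμ ≤ ‖f‖₂R/ν` is bounded UNIFORMLY in `N` and `μ`; the
crux is only about its spectral DISTRIBUTION. (The second known input, Foias–Guillopé–Temam
`⟨|Au|^{2/3}⟩ ≤ c`, FMRT IV (3.6), is a time-average estimate not available row-by-row here.) -/

section Budget

/-- **Energy row for the crux's laws**: level-`N`, bounded support, stationary at all orders ⇒
`ensembleDissipation ν μ = ∫ (u, f) dμ` (`f ∈ L²`). [folklore] -/
theorem ensembleDissipation_eq_of_isStationary {ν : ℝ} {f : T3 → R3} (hf : MemLp f 2 volume) {N : ℕ}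
    {μ : Measure H3} [IsProbabilityMeasure μ] (hlev : ∀ᵐ u ∂μ, IsLevel N u) {R : ℝ}
    (hR : ∀ᵐ u ∂μ, ‖u‖ ≤ R) (hstat : IsStationary ν f N μ) :
    Torus.ensembleDissipation ν μ = ∫ u, Torus.pairing u.1 f ∂μ := by
  have h1 : Integrable (fun u : H3 => ‖u‖) μ :=
    Integrable.of_bound continuous_norm.aestronglyMeasurable R (hR.mono fun u hu => by simpa using hu)
  obtain ⟨hI, h0⟩ := hstat _ (Theorems.CubicParityLoud.Negative.frameG N)
    (Theorems.CubicParityLoud.Negative.energyPoly _) (Theorems.CubicParityLoud.Negative.isBandTest_frameG N)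
  exact Theorems.CubicParityLoud.Negative.ensembleDissipation_eq_of_energyRow hf hlev h1 hI h0

/-- The mean energy of a law supported in `‖u‖ ≤ R` is at most `R²`. [folklore] -/
theorem ensembleEnergy_le_sq {μ : Measure H3} [IsProbabilityMeasure μ] {R : ℝ} (hR : ∀ᵐ u ∂μ, ‖u‖ ≤ R) :
    Torus.ensembleEnergy μ ≤ R ^ 2 := by
  have h2 : Integrable (fun u : H3 => ‖u‖ ^ 2) μ :=
    Integrable.of_bound (continuous_norm.pow 2).aestronglyMeasurable (R ^ 2) (hR.mono fun u hu => by
      rw [Real.norm_eq_abs, abs_of_nonneg (by positivity)]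
      exact pow_le_pow_left₀ (norm_nonneg _) hu 2)
  unfold Torus.ensembleEnergy
  calc ∫ u, ‖u‖ ^ 2 ∂μ ≤ ∫ _u, R ^ 2 ∂μ := integral_mono_ae h2 (integrable_const _)
        (hR.mono fun u hu => pow_le_pow_left₀ (norm_nonneg _) hu 2)
    _ = R ^ 2 := by simp

/-- **Power ceiling for the crux's laws**: `ν ∫‖∇u‖² dμ ≤ ‖f‖₂ R` (`R ≥ 0`), uniformly in the level `N`.
[folklore] -/
theorem ensembleDissipation_le_of_isStationary {ν : ℝ} {f : T3 → R3} (hf : MemLp f 2 volume) {N : ℕ}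
    {μ : Measure H3} [IsProbabilityMeasure μ] (hlev : ∀ᵐ u ∂μ, IsLevel N u) {R : ℝ} (hR0 : 0 ≤ R)
    (hR : ∀ᵐ u ∂μ, ‖u‖ ≤ R) (hstat : IsStationary ν f N μ) :
    Torus.ensembleDissipation ν μ ≤ Real.sqrt (∫ x, ‖f x‖ ^ 2) * R := by
  have h2 : Integrable (fun u : H3 => ‖u‖ ^ 2) μ :=
    Integrable.of_bound (continuous_norm.pow 2).aestronglyMeasurable (R ^ 2) (hR.mono fun u hu => by
      rw [Real.norm_eq_abs, abs_of_nonneg (by positivity)]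
      exact pow_le_pow_left₀ (norm_nonneg _) hu 2)
  rw [ensembleDissipation_eq_of_isStationary hf hlev hR hstat]
  refine (Theorems.CubicParityLoud.Negative.integral_pairing_le hf h2).trans ?_
  gcongr
  calc Real.sqrt (Torus.ensembleEnergy μ) ≤ Real.sqrt (R ^ 2) := Real.sqrt_le_sqrt (ensembleEnergy_le_sq hR)
    _ = R := Real.sqrt_sq hR0

/-- The mean enstrophy of a level-`N` law with bounded support is finite. [folklore] -/
theorem ensembleEnstrophy_ne_top {N : ℕ} {μ : Measure H3} [IsProbabilityMeasure μ] (hlev : ∀ᵐ u ∂μ, IsLevel N u)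
    {R : ℝ} (hR : ∀ᵐ u ∂μ, ‖u‖ ≤ R) : Torus.ensembleEnstrophy μ ≠ ⊤ := by
  have h1 := ensembleEnstrophy_le_of_level hlev
  have h2 : ∫⁻ u : H3, ‖u‖ₑ ^ 2 ∂μ ≤ ∫⁻ _u : H3, ENNReal.ofReal (R ^ 2) ∂μ :=
    lintegral_mono_ae (hR.mono fun u hu => by
      rw [← ofReal_norm, ← ENNReal.ofReal_pow (norm_nonneg _)]
      exact ENNReal.ofReal_le_ofReal (pow_le_pow_left₀ (norm_nonneg _) hu 2))
  rw [lintegral_const, measure_univ, mul_one] at h2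
  exact ne_top_of_le_ne_top (ENNReal.mul_ne_top ENNReal.ofReal_ne_top (ne_top_of_le_ne_top ENNReal.ofReal_ne_top h2)) h1

/-- **The quantity to be resolved is `N`-uniformly bounded**: `∫⁻ ‖∇u‖² dμ ≤ ‖f‖₂ R / ν` for every law
admitted by the crux at `(f, ν, R)`, whatever the level. Only the spectral distribution of this bounded
budget is at stake in `ResolvedDissipation`. [folklore] -/
theorem ensembleEnstrophy_le_of_isStationary {ν : ℝ} (hν : 0 < ν) {f : T3 → R3} (hf : MemLp f 2 volume)
    {N : ℕ} {μ : Measure H3} [IsProbabilityMeasure μ] (hlev : ∀ᵐ u ∂μ, IsLevel N u) {R : ℝ} (hR0 : 0 ≤ R)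
    (hR : ∀ᵐ u ∂μ, ‖u‖ ≤ R) (hstat : IsStationary ν f N μ) :
    Torus.ensembleEnstrophy μ ≤ ENNReal.ofReal (Real.sqrt (∫ x, ‖f x‖ ^ 2) * R / ν) := by
  have h := ensembleDissipation_le_of_isStationary hf hlev hR0 hR hstat
  unfold Torus.ensembleDissipation at h
  rw [← ENNReal.ofReal_toReal (ensembleEnstrophy_ne_top hlev hR)]
  refine ENNReal.ofReal_le_ofReal ?_
  rw [le_div_iff₀ hν, mul_comm]
  exact h

end Budget


/-! ## §7 Schedule calculus (information for provers): resolution is monotone in the cutoff and the tolerance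

So a schedule may always be replaced by a larger one (e.g. its running maximum, or `max κ N₀`): WLOG `κ` is
monotone and exceeds any given level. -/

section Schedule

/-- Truncated enstrophy is monotone in the cutoff: `‖∇P_K v‖² ≤ ‖∇P_{K'} v‖²` for `K ≤ K'` (integrable `v`).
[folklore] -/
theorem eGradNormSq_fourierTruncate_mono {K K' : ℕ} (hKK' : K ≤ K') {v : T3 → R3} (hv : Integrable v volume) :
    Torus.eGradNormSq (Torus.fourierTruncate K v) ≤ Torus.eGradNormSq (Torus.fourierTruncate K' v) := by
  rw [Torus.eGradNormSq_eq_tsum, Torus.eGradNormSq_eq_tsum]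
  gcongr with k
  rw [Torus.mFourierCoeff_fourierTruncate hv K k, Torus.mFourierCoeff_fourierTruncate hv K' k]
  by_cases hk : k ∈ Torus.freqBall K
  · rw [if_pos hk, if_pos (Torus.freqBall_mono hKK' hk)]
  · rw [if_neg hk]
    simp

/-- **Resolution is monotone in the schedule**: a larger cutoff at step `n` still resolves. [folklore] -/
theorem IsResolved.mono {κ κ' : ℕ → ℕ} {μ : Measure H3} {n : ℕ} (h : IsResolved κ μ n) (hκ : κ n ≤ κ' n) :
    IsResolved κ' μ n := by
  unfold IsResolved at h ⊢
  refine h.trans ?_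
  gcongr with u
  exact eGradNormSq_fourierTruncate_mono hκ ((Lp.memLp (u.1 : L2T3)).integrable one_le_two)

/-- **Resolution is monotone in the tolerance**: the cutoff `κ n` also serves every coarser tolerance
`1/(m+1) ≥ 1/(n+1)`. [folklore] -/
theorem IsResolved.of_le {κ : ℕ → ℕ} {μ : Measure H3} {m n : ℕ} (h : IsResolved κ μ n) (hmn : m ≤ n) :
    IsResolved (fun _ => κ n) μ m := by
  unfold IsResolved at h ⊢
  refine h.trans ?_
  gcongr

end Schedule

end Summit.AnomalousDissipation.AnomalousDissipation.Cruxes.ResolvedDissipation.Disproof
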